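import Summits.NavierStokesRegularity.NavierStokesRegularity.Theorems.SoloInformedIncomingNode

/-!
# Resonance at the vorticity-carrying node: CIV's node analysis without the outgoing hypothesis

Solo seat `solo-NavierStokesRegularity-informed` (session 7; note `paper/incoming-stagnation.md` §4b,
THEOREM B). Reading the proofs of [ConstantinIgnatovaVicol2026Euler] Thm 3.8 / Prop 3.9 / Thm 3.10
WITHOUT their local outgoing hypothesis gives, for a smooth self-similar Euler profile with `0 < γ < 1/2`
whose vorticity `Ω` is not flat at every node (e.g. real-analytic near the nodal set), a node `y*` of
`V = γ y + U` and an order `m = ord_{y*} Ω < ∞` such that the spectrum `ν₁ ≤ ν₂ ≤ ν₃` of `∇V(y*)`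
(symmetric when `m ≥ 1`; for `m = 0` read `νᵢ = γ + 1` with `1` the eigenvalue of `sym ∇U(y*)` carried by
`Ω(y*)`) satisfies the RESONANCE `νᵢ - Σₖ αₖ νₖ = 1 + γ` for some `i` and some multi-index `α` with
`|α| = m` (this is the vanishing of CIV's factor `1 + mγ - λᵢ + Σₖ αₖ λₖ`, `λ = ν - γ`), together with
`tr ∇V(y*) = ν₁ + ν₂ + ν₃ = 3γ` (`div U = 0`). WHAT IS FORMALISED: the arithmetic consequence — such a
resonance forces the node to be INCOMING with rate `-ν₁ ≥ (1 - 2γ)/(m + 2)` (`resonance_forces_incoming`);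
in particular a node all of whose rates are `≥ 0` admits no resonance when `γ < 1/2`
(`no_resonance_at_nonincoming_node`, which is CIV's Prop 3.9/Thm 3.10 mechanism in one line), and the
`m = 0` case: a trace-free symmetric matrix with eigenvalue `1` has `λ_min ≤ -1/2`, so the node carrying
non-zero vorticity is incoming with rate `≥ 1/2 - γ` (`caseA_minEig_le`, `caseA_incoming`). Compare
`incomingRate_le_of_kelvin_stretching` (Theorem A′: SOME node has rate `≥ 1 - 2γ`, no smoothness or
flatness hypothesis, but no information on which node). Elementary. [new reading of
[ConstantinIgnatovaVicol2026Euler] §3; the analysis (derivation of the resonance factor, vorticity transport)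
is theirs and is not formalised]
-/

namespace Summit.NavierStokesRegularity.NavierStokesRegularity.Theorems

/-- **Resonance forces an incoming direction, quantitatively.** At a node with `tr ∇V = 3γ`, all rates
`νₖ ≥ -r`, and a resonance `νᵢ - (α₁ν₁ + α₂ν₂ + α₃ν₃) = 1 + γ` with `αₖ ≥ 0`, `Σ αₖ = m`,
one has `(m + 2) r ≥ 1 - 2γ`. -/
theorem resonance_forces_incoming {γ r ν₁ ν₂ ν₃ νi α₁ α₂ α₃ m : ℝ}
    (h₁ : -r ≤ ν₁) (h₂ : -r ≤ ν₂) (h₃ : -r ≤ ν₃) (htr : ν₁ + ν₂ + ν₃ = 3 * γ)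
    (hi : νi = ν₁ ∨ νi = ν₂ ∨ νi = ν₃) (hα₁ : 0 ≤ α₁) (hα₂ : 0 ≤ α₂) (hα₃ : 0 ≤ α₃)
    (hm : α₁ + α₂ + α₃ = m) (hres : νi - (α₁ * ν₁ + α₂ * ν₂ + α₃ * ν₃) = 1 + γ) :
    1 - 2 * γ ≤ (m + 2) * r := by
  have hνi : νi ≤ 3 * γ + 2 * r := by
    rcases hi with h | h | h <;> subst h <;> linarith
  have hsum : -(α₁ * ν₁ + α₂ * ν₂ + α₃ * ν₃) ≤ m * r := by
    have e₁ : 0 ≤ α₁ * (ν₁ + r) := mul_nonneg hα₁ (by linarith)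
    have e₂ : 0 ≤ α₂ * (ν₂ + r) := mul_nonneg hα₂ (by linarith)
    have e₃ : 0 ≤ α₃ * (ν₃ + r) := mul_nonneg hα₃ (by linarith)
    rw [← hm]; nlinarith
  nlinarith

/-- CIV's mechanism in one line: at a node whose rates are all `≥ 0` (linearly non-incoming, in particular
locally outgoing) no resonance of any order occurs when `γ < 1/2` — hence, by their induction, `Ω`
vanishes there to infinite order. -/
theorem no_resonance_at_nonincoming_node {γ ν₁ ν₂ ν₃ νi α₁ α₂ α₃ m : ℝ} (hγ : γ < 1 / 2)
    (h₁ : 0 ≤ ν₁) (h₂ : 0 ≤ ν₂) (h₃ : 0 ≤ ν₃) (htr : ν₁ + ν₂ + ν₃ = 3 * γ)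
    (hi : νi = ν₁ ∨ νi = ν₂ ∨ νi = ν₃) (hα₁ : 0 ≤ α₁) (hα₂ : 0 ≤ α₂) (hα₃ : 0 ≤ α₃)
    (hm : α₁ + α₂ + α₃ = m) : νi - (α₁ * ν₁ + α₂ * ν₂ + α₃ * ν₃) ≠ 1 + γ := by
  intro hres
  have := resonance_forces_incoming (r := 0) (by linarith) (by linarith) (by linarith) htr hi
    hα₁ hα₂ hα₃ hm hres
  linarith

/-- The `m = 0` case (non-zero vorticity at the node, [ConstantinIgnatovaVicol2026Euler] Thm 3.8 set-up):
`Ω(y*)` is an eigenvector of the trace-free symmetric `S = sym ∇U(y*)` with eigenvalue `1`, so the smallest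
eigenvalue of `S` is `≤ -1/2`. -/
theorem caseA_minEig_le {l₁ l₂ l₃ : ℝ} (htr : l₁ + l₂ + l₃ = 0) (h₁₂ : l₁ ≤ l₂) (h₂₃ : l₂ ≤ l₃)
    (hone : l₁ = 1 ∨ l₂ = 1 ∨ l₃ = 1) : l₁ ≤ -1 / 2 := by
  rcases hone with h | h | h <;> linarith

/-- … hence that node is incoming for the similarity flow with rate `≥ 1/2 - γ = (1 - 2γ)/2`
(the `m = 0` instance of `resonance_forces_incoming`'s bound `(1 - 2γ)/(m + 2)`). -/
theorem caseA_incoming {γ l₁ l₂ l₃ : ℝ} (htr : l₁ + l₂ + l₃ = 0) (h₁₂ : l₁ ≤ l₂) (h₂₃ : l₂ ≤ l₃)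
    (hone : l₁ = 1 ∨ l₂ = 1 ∨ l₃ = 1) : γ + l₁ ≤ -((1 - 2 * γ) / 2) := by
  have := caseA_minEig_le htr h₁₂ h₂₃ hone
  linarith

/-- Bookkeeping: Theorem A′'s rate `1 - 2γ` dominates Theorem B's rate `(1 - 2γ)/(m + 2)` for every
order `m ≥ 0` when `γ ≤ 1/2` — A′ is the stronger quantitative statement, B says which node. -/
theorem rateA_ge_rateB {γ m : ℝ} (hγ : γ ≤ 1 / 2) (hm : 0 ≤ m) :
    (1 - 2 * γ) / (m + 2) ≤ 1 - 2 * γ := by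
  rw [div_le_iff₀ (by linarith)]
  nlinarith

end Summit.NavierStokesRegularity.NavierStokesRegularity.Theorems
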